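import Summits.PneNP.PneNP.Theorems.SymmetryBudgetNoHiddenOrderValueAndParts

/-!
# `NoHiddenOrder` (stmt-PneNP-14781), (R2c) value layer V: semantics of the value module at a section node — the pasted bits

Route `PneNP/SymmetryBudget`; continues `SymmetryBudgetNoHiddenOrderValueAndParts.lean`.  With every part valued (`f` the part values): the row
sources read `Covers` (`sem_rowSrc_iff`), the colour bits read `PCol` (`sem_pCol_iff`), the same-copy tests read `SameCopy` (`sem_sameCopy_iff`), the
colour-level switching data read `SwCompC` (`sem_swcc_iff`), the adjacency bits read `PAdj` (`sem_pAdj_iff`); hence the output wires `aw b` carry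
`CGBits.paste G n I f` (`aw_iff`).  Also `CGBits.paste_congr`: `paste` reads `f` only on the parts (the hypothesis `hpaste` of `val_andNode_cg`).
Sorry-free; supports stmt-PneNP-14781.
-/

set_option linter.dupNamespace false -- `Summit.PneNP.PneNP.…` (D-0017 single-conjunct layout)

namespace Summit.PneNP.PneNP.Theorems

open Finset Literature.Computability.Complexity Literature.Computability.Complexity.SymProg CGBits BranchSum

/-! ### `paste` reads the part values only on the parts -/

namespace CGBits

variable {V : Type*} [DecidableEq V] {G : SimpleGraph V} [DecidableRel G.Adj] {n : ℕ} {I : CGInst V} {f f' : CGInst V → BVal n}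

/-- `ltCnt` at a part reads `f` on parts only. [folklore] -/
theorem ltCnt_congr_parts (hff : ∀ J ∈ cgParts G I, f J = f' J) {J : CGInst V} (hJ : J ∈ cgParts G I) :
    ltCnt G n I f J = ltCnt G n I f' J := by
  unfold ltCnt
  rw [hff J hJ]
  refine sum_congr (filter_congr fun J' hJ' => by rw [hff J' hJ']) fun _ _ => rfl

/-- `mult` at a part reads `f` on parts only. [folklore] -/
theorem mult_congr_parts (hff : ∀ J ∈ cgParts G I, f J = f' J) {J : CGInst V} (hJ : J ∈ cgParts G I) :
    mult G n I f J = mult G n I f' J := by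
  unfold mult
  rw [hff J hJ]
  exact congrArg _ (filter_congr fun J' hJ' => by rw [hff J' hJ'])

/-- `Covers` reads `f` on parts only. [folklore] -/
theorem covers_congr_parts (hff : ∀ J ∈ cgParts G I, f J = f' J) (J : CGInst V) (i : ℕ) :
    Covers G n I f J i ↔ Covers G n I f' J i := by
  unfold Covers
  constructor
  · rintro ⟨hJ, h1, h2⟩
    rw [ltCnt_congr_parts hff hJ] at h1 h2; rw [mult_congr_parts hff hJ] at h2; exact ⟨hJ, h1, h2⟩
  · rintro ⟨hJ, h1, h2⟩
    rw [← ltCnt_congr_parts hff hJ] at h1 h2; rw [← mult_congr_parts hff hJ] at h2; exact ⟨hJ, h1, h2⟩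

/-- `PCol` reads `f` on parts only. [folklore] -/
theorem pCol_congr_parts (hff : ∀ J ∈ cgParts G I, f J = f' J) (i c : Fin n) : PCol G n I f i c ↔ PCol G n I f' i c := by
  unfold PCol
  refine exists_congr fun J => ?_
  constructor
  · rintro ⟨hc, o, ho, hb⟩
    have hJ := hc.1
    rw [covers_congr_parts hff] at hc
    rw [ltCnt_congr_parts hff hJ] at ho; rw [hff J hJ] at hb
    exact ⟨hc, o, ho, hb⟩
  · rintro ⟨hc, o, ho, hb⟩
    have hJ := hc.1
    rw [← covers_congr_parts hff] at hc
    rw [← ltCnt_congr_parts hff hJ] at ho; rw [← hff J hJ] at hb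
    exact ⟨hc, o, ho, hb⟩

/-- `SameCopy` reads `f` on parts only. [folklore] -/
theorem sameCopy_congr_parts (hff : ∀ J ∈ cgParts G I, f J = f' J) (i j : Fin n) : SameCopy G n I f i j ↔ SameCopy G n I f' i j := by
  unfold SameCopy
  refine exists_congr fun J => ?_
  constructor
  · rintro ⟨hci, hcj, hq⟩
    have hJ := hci.1
    rw [covers_congr_parts hff] at hci hcj; rw [ltCnt_congr_parts hff hJ] at hq
    exact ⟨hci, hcj, hq⟩
  · rintro ⟨hci, hcj, hq⟩
    have hJ := hci.1
    rw [← covers_congr_parts hff] at hci hcj; rw [← ltCnt_congr_parts hff hJ] at hq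
    exact ⟨hci, hcj, hq⟩

/-- `PAdj` reads `f` on parts only. [folklore] -/
theorem pAdj_congr_parts (hff : ∀ J ∈ cgParts G I, f J = f' J) (i j : Fin n) : PAdj G n I f i j ↔ PAdj G n I f' i j := by
  unfold PAdj
  refine or_congr (exists_congr fun J => ?_) ?_
  · constructor
    · rintro ⟨hci, hcj, hq, o, o', ho, ho', hb⟩
      have hJ := hci.1
      rw [covers_congr_parts hff] at hci hcj; rw [ltCnt_congr_parts hff hJ] at hq ho ho'; rw [hff J hJ] at hb
      exact ⟨hci, hcj, hq, o, o', ho, ho', hb⟩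
    · rintro ⟨hci, hcj, hq, o, o', ho, ho', hb⟩
      have hJ := hci.1
      rw [← covers_congr_parts hff] at hci hcj; rw [← ltCnt_congr_parts hff hJ] at hq ho ho'; rw [← hff J hJ] at hb
      exact ⟨hci, hcj, hq, o, o', ho, ho', hb⟩
  · simp only [sameCopy_congr_parts hff, pCol_congr_parts hff]

/-- **`paste` reads the part values only on the parts.** [folklore] -/
theorem paste_congr (I : CGInst V) (f f' : CGInst V → BVal n) (hff : ∀ J ∈ cgParts G I, f J = f' J) : paste G n I f = paste G n I f' := by
  unfold paste
  split_ifs with hI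
  · funext b
    rcases bit_cases b with ⟨i, c, rfl⟩ | ⟨i, j, rfl⟩
    · simp only [bdec_cIdx]; exact decide_eq_decide.2 (pCol_congr_parts hff i c)
    · simp only [bdec_aIdx]; exact decide_eq_decide.2 (pAdj_congr_parts hff i j)
  · rfl

end CGBits

namespace VAnd

variable {ι Λ : Type*} [DecidableEq ι] [DecidableEq Λ] {P : SymProg ι Λ}
variable {V : Type*} [Fintype V] [DecidableEq V] {n : ℕ} {U : Finset V}
variable {A : VAnd P V n U} {x : ι → Bool}
variable {G : SimpleGraph V} [DecidableRel G.Adj] {I : CGInst V}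
variable {pv : Finset V → Option (BVal n)} (h : A.Hyp G x I) (he : A.Ext x pv)
variable {f : CGInst V → BVal n} (hf : ∀ J ∈ cgParts G I, pv J.1.1 = some (f J))
include h he hf

omit [DecidableRel G.Adj] h he hf in
/-- The constant false. [folklore] -/
theorem sem_ff : P.sem x A.ff = false := by
  rw [← Bool.not_eq_true, P.sem_or A.kind_ff, A.srcs_ff]; simp

/-! ### Row sources and colour bits -/

/-- **`rowSrc i U' t`** reads "row `i` is covered by the class of the part with block `U'`, which starts at row `t`". [folklore] -/
theorem sem_rowSrc_iff (i : Fin n) (U' : Finset V) (t : Fin (n + 1)) : P.sem x (A.rowSrc i U' t) = true ↔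
    ∃ J ∈ cgParts G I, J.1.1 = U' ∧ Covers G n I f J i ∧ ltCnt G n I f J = t := by
  by_cases ht : (t : ℕ) ≤ i
  · have hk : P.kind (A.rowSrc i U' t) = Kind.and := by rw [A.kind_rowSrc, if_pos ht]
    rw [P.sem_and hk, A.srcs_rowSrc, if_pos ht]
    simp only [mem_insert, mem_singleton, forall_eq_or_imp, forall_eq, wval_inr, sem_isPart_iff h]
    constructor
    · rintro ⟨⟨J, hJ, rfl⟩, hcnt, hmult⟩
      rw [sem_cntIs_iff h he hf hJ] at hcnt
      rw [sem_multGe_iff h he hf hJ] at hmult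
      refine ⟨J, hJ, rfl, ⟨hJ, hcnt ▸ ht, ?_⟩, hcnt⟩
      unfold qIdx at hmult
      simp only at hmult
      rw [hcnt]; omega
    · rintro ⟨J, hJ, rfl, hc, hcnt⟩
      refine ⟨⟨J, hJ, rfl⟩, (sem_cntIs_iff h he hf hJ t).2 hcnt, (sem_multGe_iff h he hf hJ _).2 ?_⟩
      unfold qIdx
      simp only
      have := hc.2.2
      rw [hcnt] at this; omega
  · have hk : P.kind (A.rowSrc i U' t) = Kind.or := by rw [A.kind_rowSrc, if_neg ht]
    rw [P.sem_or hk, A.srcs_rowSrc, if_neg ht]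
    simp only [notMem_empty, false_and, exists_false, false_iff, not_exists, not_and]
    rintro J hJ rfl hc hcnt
    exact ht (hcnt ▸ hc.2.1)

/-- **`pCol i c`** reads the colour bit `PCol` of the pasted value. [folklore] -/
theorem sem_pCol_iff (i c : Fin n) : P.sem x (A.pCol i c) = true ↔ PCol G n I f i c := by
  rw [P.sem_or (A.kind_pCol i c), A.srcs_pCol, exists_mem_image]
  have hpcb : ∀ U' t o, P.sem x (A.pcb i c U' t o) = true ↔
      (o : ℕ) = ((i : ℕ) - t) % U'.card ∧ P.sem x (A.rowSrc i U' t) = true ∧ wval x (P.sem x) (A.ptBit U' (cIdx o c)) = true := by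
    intro U' t o
    by_cases ho : (o : ℕ) = ((i : ℕ) - t) % U'.card
    · have hk : P.kind (A.pcb i c U' t o) = Kind.and := by rw [A.kind_pcb, if_pos ho]
      rw [P.sem_and hk, A.srcs_pcb, if_pos ho]
      simp only [mem_insert, mem_singleton, forall_eq_or_imp, forall_eq, wval_inr, ho, true_and]
    · have hk : P.kind (A.pcb i c U' t o) = Kind.or := by rw [A.kind_pcb, if_neg ho]
      rw [P.sem_or hk, A.srcs_pcb, if_neg ho]
      simp [ho]
  unfold PCol
  constructor
  · rintro ⟨⟨U', t, o⟩, _, hp⟩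
    rw [wval_inr, hpcb, sem_rowSrc_iff h he hf] at hp
    obtain ⟨ho, ⟨J, hJ, rfl, hc, hcnt⟩, hbit⟩ := hp
    rw [he.bit_iff _ (block_mem_partSets h hJ) _ (hf J hJ)] at hbit
    exact ⟨J, hc, o, by rw [hcnt]; exact ho, hbit⟩
  · rintro ⟨J, hc, o, ho, hbit⟩
    have hJ := hc.1
    have hlt : ltCnt G n I f J < n + 1 := by have := hc.2.1; have := i.2; omega
    refine ⟨⟨J.1.1, ⟨ltCnt G n I f J, hlt⟩, o⟩, mem_product.2 ⟨block_mem_partSets h hJ, mem_product.2 ⟨mem_univ _, mem_univ _⟩⟩, ?_⟩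
    rw [wval_inr, hpcb, sem_rowSrc_iff h he hf]
    exact ⟨ho, ⟨J, hJ, rfl, hc, rfl⟩, (he.bit_iff _ (block_mem_partSets h hJ) _ (hf J hJ) _).2 hbit⟩

/-! ### Same copy and the adjacency bits -/

/-- `scp i j U' t`: rows `i`, `j` lie in the same copy of the class of the part with block `U'` starting at `t`. [folklore] -/
theorem sem_scp_iff (i j : Fin n) (U' : Finset V) (t : Fin (n + 1)) : P.sem x (A.scp i j U' t) = true ↔
    ∃ J ∈ cgParts G I, J.1.1 = U' ∧ Covers G n I f J i ∧ Covers G n I f J j ∧ ltCnt G n I f J = t ∧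
      ((i : ℕ) - t) / U'.card = ((j : ℕ) - t) / U'.card := by
  by_cases hc : (t : ℕ) ≤ i ∧ (t : ℕ) ≤ j ∧ ((i : ℕ) - t) / U'.card = ((j : ℕ) - t) / U'.card
  · have hk : P.kind (A.scp i j U' t) = Kind.and := by rw [A.kind_scp, if_pos hc]
    have hr : P.sem x (A.scp i j U' t) = true ↔ P.sem x (A.rowSrc i U' t) = true := by
      have hk' : P.kind (A.rowSrc i U' t) = Kind.and := by rw [A.kind_rowSrc, if_pos hc.1]
      rw [P.sem_and hk, A.srcs_scp, if_pos hc, P.sem_and hk', A.srcs_rowSrc, if_pos hc.1]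
    rw [hr, sem_rowSrc_iff h he hf]
    constructor
    · rintro ⟨J, hJ, rfl, hci, hcnt⟩
      refine ⟨J, hJ, rfl, hci, ⟨hJ, hcnt ▸ hc.2.1, ?_⟩, hcnt, hc.2.2⟩
      rw [hcnt, ← hc.2.2]; exact hcnt ▸ hci.2.2
    · rintro ⟨J, hJ, rfl, hci, -, hcnt, -⟩
      exact ⟨J, hJ, rfl, hci, hcnt⟩
  · have hk : P.kind (A.scp i j U' t) = Kind.or := by rw [A.kind_scp, if_neg hc]
    rw [P.sem_or hk, A.srcs_scp, if_neg hc]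
    simp only [notMem_empty, false_and, exists_false, false_iff, not_exists, not_and]
    rintro J hJ rfl hci hcj hcnt hq
    exact hc ⟨hcnt ▸ hci.2.1, hcnt ▸ hcj.2.1, hq⟩

/-- **`sameCopy i j`** reads `SameCopy`. [folklore] -/
theorem sem_sameCopy_iff (i j : Fin n) : P.sem x (A.sameCopy i j) = true ↔ SameCopy G n I f i j := by
  rw [P.sem_or (A.kind_sameCopy i j), A.srcs_sameCopy, exists_mem_image]
  unfold SameCopy
  constructor
  · rintro ⟨⟨U', t⟩, _, hp⟩
    rw [wval_inr, sem_scp_iff h he hf] at hp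
    obtain ⟨J, hJ, rfl, hci, hcj, hcnt, hq⟩ := hp
    exact ⟨J, hci, hcj, by rw [hcnt]; exact hq⟩
  · rintro ⟨J, hci, hcj, hq⟩
    have hJ := hci.1
    have hlt : ltCnt G n I f J < n + 1 := by have := hci.2.1; have := i.2; omega
    refine ⟨⟨J.1.1, ⟨_, hlt⟩⟩, mem_product.2 ⟨block_mem_partSets h hJ, mem_univ _⟩, ?_⟩
    rw [wval_inr, sem_scp_iff h he hf]
    exact ⟨J, hJ, rfl, hci, hcj, rfl, hq⟩

/-- `pOwn i j`: adjacency inside one copy, the part's own bit. [folklore] -/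
theorem sem_pOwn_iff (i j : Fin n) : P.sem x (A.pOwn i j) = true ↔
    ∃ J, Covers G n I f J i ∧ Covers G n I f J j ∧
      ((i : ℕ) - ltCnt G n I f J) / J.1.1.card = ((j : ℕ) - ltCnt G n I f J) / J.1.1.card ∧
      ∃ o o' : Fin n, (o : ℕ) = ((i : ℕ) - ltCnt G n I f J) % J.1.1.card ∧ (o' : ℕ) = ((j : ℕ) - ltCnt G n I f J) % J.1.1.card ∧
        f J (aIdx o o') = true := by
  rw [P.sem_or (A.kind_pOwn i j), A.srcs_pOwn, exists_mem_image]
  have hpab : ∀ U' t o o', P.sem x (A.pab i j U' t o o') = true ↔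
      ((o : ℕ) = ((i : ℕ) - t) % U'.card ∧ (o' : ℕ) = ((j : ℕ) - t) % U'.card) ∧ P.sem x (A.scp i j U' t) = true ∧
        wval x (P.sem x) (A.ptBit U' (aIdx o o')) = true := by
    intro U' t o o'
    by_cases ho : (o : ℕ) = ((i : ℕ) - t) % U'.card ∧ (o' : ℕ) = ((j : ℕ) - t) % U'.card
    · have hk : P.kind (A.pab i j U' t o o') = Kind.and := by rw [A.kind_pab, if_pos ho]
      rw [P.sem_and hk, A.srcs_pab, if_pos ho]
      simp only [mem_insert, mem_singleton, forall_eq_or_imp, forall_eq, wval_inr, ho, true_and]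
    · have hk : P.kind (A.pab i j U' t o o') = Kind.or := by rw [A.kind_pab, if_neg ho]
      rw [P.sem_or hk, A.srcs_pab, if_neg ho]
      simp [ho]
  constructor
  · rintro ⟨⟨U', t, o, o'⟩, _, hp⟩
    rw [wval_inr, hpab, sem_scp_iff h he hf] at hp
    obtain ⟨⟨ho, ho'⟩, ⟨J, hJ, rfl, hci, hcj, hcnt, hq⟩, hbit⟩ := hp
    rw [he.bit_iff _ (block_mem_partSets h hJ) _ (hf J hJ)] at hbit
    refine ⟨J, hci, hcj, by rw [hcnt]; exact hq, o, o', by rw [hcnt]; exact ho, by rw [hcnt]; exact ho', hbit⟩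
  · rintro ⟨J, hci, hcj, hq, o, o', ho, ho', hbit⟩
    have hJ := hci.1
    have hlt : ltCnt G n I f J < n + 1 := by have := hci.2.1; have := i.2; omega
    refine ⟨⟨J.1.1, ⟨_, hlt⟩, o, o'⟩, mem_product.2 ⟨block_mem_partSets h hJ, mem_product.2 ⟨mem_univ _,
      mem_product.2 ⟨mem_univ _, mem_univ _⟩⟩⟩, ?_⟩
    rw [wval_inr, hpab, sem_scp_iff h he hf]
    exact ⟨⟨ho, ho'⟩, ⟨J, hJ, rfl, hci, hcj, rfl, hq⟩, (he.bit_iff _ (block_mem_partSets h hJ) _ (hf J hJ) _).2 hbit⟩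

omit he hf in
/-- **`swcc c c'`** reads the colour-level switching datum `SwCompC`. [folklore] -/
theorem sem_swcc_iff (c c' : Fin n) : P.sem x (A.swcc c c') = true ↔ SwCompC G I.1.1 I.1.2 c c' := by
  rw [P.sem_or (A.kind_swcc c c'), A.srcs_swcc, exists_mem_image]
  have hswu : ∀ u w, P.sem x (A.swu c c' u w) = true ↔
      u ∈ I.1.1 ∧ w ∈ I.1.1 ∧ I.1.2 u = c ∧ I.1.2 w = c' ∧ SwComp G I.1.1 I.1.2 u w := by
    intro u w
    rw [P.sem_and (A.kind_swu c c' u w), A.srcs_swu]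
    simp only [mem_insert, mem_singleton, forall_eq_or_imp, forall_eq, h.mem_iff, h.val_iff]
    constructor
    · rintro ⟨hu, hw, hcu, hcw, ht⟩; exact ⟨hu, hw, hcu, hcw, (h.tw_iff u hu w hw).1 ht⟩
    · rintro ⟨hu, hw, hcu, hcw, ht⟩; exact ⟨hu, hw, hcu, hcw, (h.tw_iff u hu w hw).2 ht⟩
  constructor
  · rintro ⟨⟨u, w⟩, -, hs⟩
    rw [wval_inr, hswu] at hs
    obtain ⟨-, -, hcu, hcw, ht⟩ := hs
    rw [← hcu, ← hcw, swCompC_iff]; exact ht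
  · intro H
    -- both colour classes are non-empty, else the datum is `0 < 0`
    have hne : (I.1.1.filter fun w => I.1.2 w = c).Nonempty ∧ (I.1.1.filter fun w => I.1.2 w = c').Nonempty := by
      unfold SwCompC at H
      by_contra hem
      rw [not_and_or, not_nonempty_iff_eq_empty, not_nonempty_iff_eq_empty] at hem
      rcases hem with hem | hem <;> rw [hem] at H <;> simp at H
    obtain ⟨⟨u, hu⟩, ⟨w, hw⟩⟩ := hne
    obtain ⟨huA, hcu⟩ := mem_filter.1 hu
    obtain ⟨hwA, hcw⟩ := mem_filter.1 hw
    refine ⟨(u, w), mem_univ _, ?_⟩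
    rw [wval_inr, hswu]
    refine ⟨huA, hwA, hcu, hcw, ?_⟩
    rw [← swCompC_iff, hcu, hcw]; exact H

/-- `xc i j`: the cross bit of the colours of rows `i`, `j`. [folklore] -/
theorem sem_xc_iff (i j : Fin n) : P.sem x (A.xc i j) = true ↔ ∃ c c' : Fin n, PCol G n I f i c ∧ PCol G n I f j c' ∧ SwCompC G I.1.1 I.1.2 c c' := by
  rw [P.sem_or (A.kind_xc i j), A.srcs_xc, exists_mem_image]
  have hx : ∀ c c', P.sem x (A.xcp i j c c') = true ↔ PCol G n I f i c ∧ PCol G n I f j c' ∧ SwCompC G I.1.1 I.1.2 c c' := by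
    intro c c'
    rw [P.sem_and (A.kind_xcp i j c c'), A.srcs_xcp]
    simp only [mem_insert, mem_singleton, forall_eq_or_imp, forall_eq, wval_inr, sem_pCol_iff h he hf, sem_swcc_iff h]
  constructor
  · rintro ⟨⟨c, c'⟩, -, hs⟩
    rw [wval_inr, hx] at hs
    exact ⟨c, c', hs⟩
  · rintro ⟨c, c', hs⟩
    refine ⟨(c, c'), mem_univ _, ?_⟩
    rw [wval_inr, hx]; exact hs

/-- **`pAdj i j`** reads the adjacency bit `PAdj` of the pasted value. [folklore] -/
theorem sem_pAdj_iff (i j : Fin n) : P.sem x (A.pAdj i j) = true ↔ PAdj G n I f i j := by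
  rw [P.sem_or (A.kind_pAdj i j), A.srcs_pAdj]
  simp only [mem_insert, mem_singleton, exists_eq_or_imp, exists_eq_left, wval_inr, sem_pOwn_iff h he hf]
  rw [P.sem_and (A.kind_pX i j), A.srcs_pX]
  simp only [mem_insert, mem_singleton, forall_eq_or_imp, forall_eq, wval_inr, sem_xc_iff h he hf,
    P.sem_nor_singleton (A.kind_nsame i j) (A.srcs_nsame i j), Bool.not_eq_true']
  rw [← Bool.not_eq_true, sem_sameCopy_iff h he hf]
  rfl

/-- **The output wires carry the pasted value.** [folklore] -/
theorem aw_iff (b : Fin (NB n)) : wval x (P.sem x) (A.aw b) = true ↔ paste G n I f b = true := by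
  unfold paste
  rw [if_pos h.wf]
  rcases bit_cases b with ⟨i, c, rfl⟩ | ⟨i, j, rfl⟩
  · unfold aw; simp only [bdec_cIdx, wval_inr, decide_eq_true_eq]; exact sem_pCol_iff h he hf i c
  · unfold aw; simp only [bdec_aIdx, wval_inr, decide_eq_true_eq]; exact sem_pAdj_iff h he hf i j

end VAnd

end Summit.PneNP.PneNP.Theorems
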